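import Summits.BirchSwinnertonDyer.BirchSwinnertonDyer.Theorems.EisensteinPrimesMazurMCOnCellBTwistbackSubrowDatumTwistBack
import Summits.BirchSwinnertonDyer.BirchSwinnertonDyer.Theorems.EisensteinPrimesMazurMCOnCellBTwistbackSubrowDatumIsogeny
import Summits.BirchSwinnertonDyer.Rank1Residual.X2.Cells
import HarnessLib

/-!
# Crux 3 `MazurMCOnCellB` (stmt-BirchSwinnertonDyer-19033), line `twistback` v12 — lane ISO-4c:
# THE SUB-ROW IS A UNION OF CONNECTED COMPONENTS of the admissible double-twist graph (up to isogeny at the ends)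

Width seat bsd-line-x2-p1-w7 (gen 4), cell `bsd-eis` (run/shared/lean/pub/bsd-eis/), 2026-08-29; assembly of ISO-2
(`…TwistbackSubrowDatumIsogeny`, p681078: the datum is a CLASS datum), ISO-4a (`…TwistbackSubrowDatumTwistStep`:
forward along an admissible twist) and ISO-4b (`…TwistbackSubrowDatumTwistBack`: backward). HONEST FRAMING: TOOL
THEOREMS ONLY (no `def`, no named fact, no `sorry`); every input a tree THEOREM; `--supports`
stmt-BirchSwinnertonDyer-19033; closes no stub; no summit statement, no Mazur main conjecture, no BSD is proved for
any curve; 0 cells / labels / stubs / tiers move.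

WHAT. The registered v12 stub `stub_offSubrow_connectedShaUnitOrPartner` concludes, at an X2b pair `(W, 3)` OFF the
sub-row, a disjunction of two data each of which lives on the CONNECTED COMPONENT of `W` in the graph whose vertices are
globally minimal curves, identified up to `ℚ`-isogeny at the ends, and whose edges are the zig-zags
`Relation.ReflTransGen (A B ↦ TwoStepAt 3 A B ∨ (TwoStepAt 3 B A ∧ (B, 3) is X2b))` (VERBATIM the relation of the
stub). Width seat x2-p1-w3 g15/g16 proved that both disjuncts are CONSTANT on these components (`…ZigzagClassData`,
`…ConnectedPartnerClassData`). This file proves the same for the HYPOTHESIS: the sub-row datum holds at `W` iff it holds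
at `W₀` whenever `W ∼ W₁ ⇝ U ∼ W₀` (`W` multiplicative at `3`) — so every clause of the registered stub is a datum of the
component, and the registered open content of the line is a set of COMPONENTS.

* §1 `hasMultiplicativeReductionAtPrime_of_twoStepAt` — multiplicative reduction at `3` moves along an edge.
* §2 `subrowDatum_of_twoStepAt_symm` — the datum moves BACKWARD along an edge (ISO-4b twice).
* §3 **`subrowDatum_iff_of_zigzag`** — constant along zig-zags (induction; forward edges by ISO-4a
  `subrowDatum_of_twoStepAt` / ISO-4b, reversed edges by the same two with the roles exchanged, the X2b clause
  supplying multiplicative reduction at the far vertex).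
* §4 **`subrowDatum_iff_of_isIsogenous_zigzag`** — with ISO-2 at both ends: constant on components up to isogeny.

References: [GreenbergVatsal2000] §2 Prop. (2.4) p. 22, p. 28, §3 (28) p. 42; [SilvermanAEC2009] X.5 Cor. 5.4,
VII.5 Prop. 5.1, III.4/III.6; [Washington1997] Ch. 3.
-/

set_option autoImplicit false

-- `Summit.BirchSwinnertonDyer.BirchSwinnertonDyer.…`: the summit and its single sub-problem share a name.
set_option linter.dupNamespace false

noncomputable section

open scoped Classical

open WeierstrassCurve NumberField IsDedekindDomain Field
  Literature.NumberTheory.EllipticCurves Literature.NumberTheory.GaloisRepresentations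
  Literature.NumberTheory.EllipticCurves.GreenbergVatsal2000
  Literature.NumberTheory.EllipticCurves.Rank1Residual
  Summit.BirchSwinnertonDyer.Rank1Residual Summit.BirchSwinnertonDyer.Rank1Residual.X2
  Summit.BirchSwinnertonDyer.BirchSwinnertonDyer.Theorems.EisensteinPrimesMazurMCOnCellBTwistbackTwoStepDefs
  Summit.BirchSwinnertonDyer.BirchSwinnertonDyer.Theorems.EisensteinPrimesMazurMCOnCellBTwistbackSubrowDatumIsogeny
  Summit.BirchSwinnertonDyer.BirchSwinnertonDyer.Theorems.EisensteinPrimesMazurMCOnCellBTwistbackSubrowDatumTwistStep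
  Summit.BirchSwinnertonDyer.BirchSwinnertonDyer.Theorems.EisensteinPrimesMazurMCOnCellBTwistbackSubrowDatumTwistBack

namespace Summit.BirchSwinnertonDyer.BirchSwinnertonDyer.Theorems.EisensteinPrimesMazurMCOnCellBTwistbackSubrowDatumZigzag

/-! ## §1. Multiplicative reduction at `3` along an edge -/

/-- **Multiplicative reduction at `3` moves along a certified two-step edge** (two odd twists by discriminants prime to
`3`; `X2.hasMultiplicativeReductionAtPrime_of_smul_eq_quadraticTwist`). [cite: SilvermanAEC2009, VII.5 Prop. 5.1(b) and X.5 Cor. 5.4] -/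
theorem hasMultiplicativeReductionAtPrime_of_twoStepAt {W W'' : WeierstrassCurve ℚ} (h : TwoStepAt 3 W W'')
    (hmult : W.HasMultiplicativeReductionAtPrime 3) : W''.HasMultiplicativeReductionAtPrime 3 := by
  obtain ⟨iW, iWm, iW'', -, K, _, _, hK, -, hH3, -, -, -, Wd, iWd, iWdm, ⟨C, hC⟩, K'', _, _, hK'', -, -, -, hH3'', -,
    C'', hC''⟩ := h
  have hp2 : (3 : ℕ) ≠ 2 := by decide
  have hpD : ¬ ((3 : ℕ) : ℤ) ∣ NumberField.discr K :=
    Literature.SatisfiesHeegnerHypothesis.not_dvd_discr hK.1 hH3 Nat.prime_three dvd_rfl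
  have hpD'' : ¬ ((3 : ℕ) : ℤ) ∣ NumberField.discr K'' :=
    Literature.SatisfiesHeegnerHypothesis.not_dvd_discr hK''.1 hH3'' Nat.prime_three dvd_rfl
  exact hasMultiplicativeReductionAtPrime_of_smul_eq_quadraticTwist Wd W'' hC'' 3 hp2 hpD''
    (hasMultiplicativeReductionAtPrime_of_smul_eq_quadraticTwist W Wd hC 3 hp2 hpD hmult)

/-! ## §2. The datum moves BACKWARD along an edge -/

/-- **The sub-row datum moves backward along a certified two-step edge**: if `TwoStepAt 3 W W″`, `W` is multiplicative
at `3` and `(W″, 3)` is on the sub-row, then `(W, 3)` is on the sub-row (ISO-4b twice: `W″ ↦ Wd ↦ W`).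
[cite: GreenbergVatsal2000, §2 Prop. (2.4) p. 22 and §3 (28) p. 42] [cite: SilvermanAEC2009, X.5 Cor. 5.4] -/
theorem subrowDatum_of_twoStepAt_symm {W W'' : WeierstrassCurve ℚ} (h : TwoStepAt 3 W W'')
    (hmult : W.HasMultiplicativeReductionAtPrime 3) (q : ℕ)
    (hD : q = 3 ∧ ¬ W''.HasSplitMultiplicativeReductionAtPrime 3 ∧
      ∃ (Φ₀ : AddSubgroup (geomTorsion W'' (3 : ℤ))) (m : ℕ) (_ : NeZero m) (φ : DirichletCharacter (ZMod 3) m)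
        (d : ℕ) (_ : NeZero d) (ψ : DirichletCharacter (ZMod 3) d) (S₀ : Finset (HeightOneSpectrum (𝓞 ℚ))),
        IsRationalLine W'' 3 Φ₀ ∧ φ.IsPrimitive ∧ ψ.IsPrimitive ∧
        (∀ (σ : absoluteGaloisGroup ℚ), ∀ P ∈ Φ₀,
          σ • P = (φ ((modNCyclotomicCharacter ℚ m σ : (ZMod m)ˣ) : ZMod m)).val • P) ∧
        (∀ (σ : absoluteGaloisGroup ℚ) (P : geomTorsion W'' (3 : ℤ)),
          σ • P - (ψ ((modNCyclotomicCharacter ℚ d σ : (ZMod d)ˣ) : ZMod d)).val • P ∈ Φ₀) ∧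
        (∀ v ∈ S₀, ((3 : ℕ) : 𝓞 ℚ) ∉ v.asIdeal) ∧
        (∀ v : HeightOneSpectrum (𝓞 ℚ), v ∉ S₀ → ((3 : ℕ) : 𝓞 ℚ) ∉ v.asIdeal → W''.HasGoodReductionAt v) ∧
        1 + ∑ v ∈ S₀, delta W'' 3 v =
          ∑ v ∈ S₀, ((if φ (Rat.HeightOneSpectrum.natGenerator v : ZMod m) =
                (Rat.HeightOneSpectrum.natGenerator v : ZMod 3)
              then sFactor 3 (Rat.HeightOneSpectrum.natGenerator v) else 0) +
            (if ψ (Rat.HeightOneSpectrum.natGenerator v : ZMod d) =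
                (Rat.HeightOneSpectrum.natGenerator v : ZMod 3)
              then sFactor 3 (Rat.HeightOneSpectrum.natGenerator v) else 0))) :
    q = 3 ∧ ¬ W.HasSplitMultiplicativeReductionAtPrime 3 ∧
      ∃ (Φ₀ : AddSubgroup (geomTorsion W (3 : ℤ))) (m : ℕ) (_ : NeZero m) (φ : DirichletCharacter (ZMod 3) m)
        (d : ℕ) (_ : NeZero d) (ψ : DirichletCharacter (ZMod 3) d) (S₀ : Finset (HeightOneSpectrum (𝓞 ℚ))),
        IsRationalLine W 3 Φ₀ ∧ φ.IsPrimitive ∧ ψ.IsPrimitive ∧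
        (∀ (σ : absoluteGaloisGroup ℚ), ∀ P ∈ Φ₀,
          σ • P = (φ ((modNCyclotomicCharacter ℚ m σ : (ZMod m)ˣ) : ZMod m)).val • P) ∧
        (∀ (σ : absoluteGaloisGroup ℚ) (P : geomTorsion W (3 : ℤ)),
          σ • P - (ψ ((modNCyclotomicCharacter ℚ d σ : (ZMod d)ˣ) : ZMod d)).val • P ∈ Φ₀) ∧
        (∀ v ∈ S₀, ((3 : ℕ) : 𝓞 ℚ) ∉ v.asIdeal) ∧
        (∀ v : HeightOneSpectrum (𝓞 ℚ), v ∉ S₀ → ((3 : ℕ) : 𝓞 ℚ) ∉ v.asIdeal → W.HasGoodReductionAt v) ∧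
        1 + ∑ v ∈ S₀, delta W 3 v =
          ∑ v ∈ S₀, ((if φ (Rat.HeightOneSpectrum.natGenerator v : ZMod m) =
                (Rat.HeightOneSpectrum.natGenerator v : ZMod 3)
              then sFactor 3 (Rat.HeightOneSpectrum.natGenerator v) else 0) +
            (if ψ (Rat.HeightOneSpectrum.natGenerator v : ZMod d) =
                (Rat.HeightOneSpectrum.natGenerator v : ZMod 3)
              then sFactor 3 (Rat.HeightOneSpectrum.natGenerator v) else 0)) := by
  obtain ⟨iW, iWm, iW'', iW''m, K, _, _, hK, hHN, hH3, hodd, -, -, Wd, iWd, iWdm, ⟨C, hC⟩, K'', _, _, hK'', hodd'', -,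
    hHN'', hH3'', -, C'', hC''⟩ := h
  have hp2 : (3 : ℕ) ≠ 2 := by decide
  have hpD : ¬ ((3 : ℕ) : ℤ) ∣ NumberField.discr K :=
    Literature.SatisfiesHeegnerHypothesis.not_dvd_discr hK.1 hH3 Nat.prime_three dvd_rfl
  have hmultd : Wd.HasMultiplicativeReductionAtPrime 3 :=
    hasMultiplicativeReductionAtPrime_of_smul_eq_quadraticTwist W Wd hC 3 hp2 hpD hmult
  have h1 := subrowDatum_of_twist Wd K'' hK'' hodd'' hHN'' hH3'' W'' C'' hC'' hmultd q hD
  exact subrowDatum_of_twist W K hK hodd hHN hH3 Wd C hC hmult q h1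

/-! ## §3. Constant along zig-zags -/

/-- **THE SUB-ROW DATUM IS CONSTANT ALONG ZIG-ZAGS.** For the stub's relation (a step is a certified two-step edge
`A → B`, or a reversed one `B → A` into an X2b vertex `B`) and `W₁` multiplicative at `3`: if `W₁ ⇝ U` then `U` is
multiplicative at `3` and the sub-row datum holds at `W₁` iff it holds at `U` (forward edges: ISO-4a
`subrowDatum_of_twoStepAt` and §2; reversed edges: the same two with the roles exchanged, multiplicativity at the X2b
vertex from `X2.CellB`). [cite: GreenbergVatsal2000, §2 Prop. (2.4) p. 22 and §3 (28) p. 42] -/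
theorem subrowDatum_iff_of_zigzag {W₁ U : WeierstrassCurve ℚ}
    (hz : Relation.ReflTransGen (fun A B : WeierstrassCurve ℚ ↦ TwoStepAt 3 A B ∨
        (TwoStepAt 3 B A ∧ ∃ (_ : B.IsElliptic) (_ : B.IsGloballyMinimal), X2.CellB B 3)) W₁ U)
    (hmult : W₁.HasMultiplicativeReductionAtPrime 3) (q : ℕ) :
    U.HasMultiplicativeReductionAtPrime 3 ∧
    ((q = 3 ∧ ¬ W₁.HasSplitMultiplicativeReductionAtPrime 3 ∧
      ∃ (Φ₀ : AddSubgroup (geomTorsion W₁ (3 : ℤ))) (m : ℕ) (_ : NeZero m) (φ : DirichletCharacter (ZMod 3) m)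
        (d : ℕ) (_ : NeZero d) (ψ : DirichletCharacter (ZMod 3) d) (S₀ : Finset (HeightOneSpectrum (𝓞 ℚ))),
        IsRationalLine W₁ 3 Φ₀ ∧ φ.IsPrimitive ∧ ψ.IsPrimitive ∧
        (∀ (σ : absoluteGaloisGroup ℚ), ∀ P ∈ Φ₀,
          σ • P = (φ ((modNCyclotomicCharacter ℚ m σ : (ZMod m)ˣ) : ZMod m)).val • P) ∧
        (∀ (σ : absoluteGaloisGroup ℚ) (P : geomTorsion W₁ (3 : ℤ)),
          σ • P - (ψ ((modNCyclotomicCharacter ℚ d σ : (ZMod d)ˣ) : ZMod d)).val • P ∈ Φ₀) ∧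
        (∀ v ∈ S₀, ((3 : ℕ) : 𝓞 ℚ) ∉ v.asIdeal) ∧
        (∀ v : HeightOneSpectrum (𝓞 ℚ), v ∉ S₀ → ((3 : ℕ) : 𝓞 ℚ) ∉ v.asIdeal → W₁.HasGoodReductionAt v) ∧
        1 + ∑ v ∈ S₀, delta W₁ 3 v =
          ∑ v ∈ S₀, ((if φ (Rat.HeightOneSpectrum.natGenerator v : ZMod m) =
                (Rat.HeightOneSpectrum.natGenerator v : ZMod 3)
              then sFactor 3 (Rat.HeightOneSpectrum.natGenerator v) else 0) +
            (if ψ (Rat.HeightOneSpectrum.natGenerator v : ZMod d) =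
                (Rat.HeightOneSpectrum.natGenerator v : ZMod 3)
              then sFactor 3 (Rat.HeightOneSpectrum.natGenerator v) else 0))) ↔
     (q = 3 ∧ ¬ U.HasSplitMultiplicativeReductionAtPrime 3 ∧
      ∃ (Φ₀ : AddSubgroup (geomTorsion U (3 : ℤ))) (m : ℕ) (_ : NeZero m) (φ : DirichletCharacter (ZMod 3) m)
        (d : ℕ) (_ : NeZero d) (ψ : DirichletCharacter (ZMod 3) d) (S₀ : Finset (HeightOneSpectrum (𝓞 ℚ))),
        IsRationalLine U 3 Φ₀ ∧ φ.IsPrimitive ∧ ψ.IsPrimitive ∧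
        (∀ (σ : absoluteGaloisGroup ℚ), ∀ P ∈ Φ₀,
          σ • P = (φ ((modNCyclotomicCharacter ℚ m σ : (ZMod m)ˣ) : ZMod m)).val • P) ∧
        (∀ (σ : absoluteGaloisGroup ℚ) (P : geomTorsion U (3 : ℤ)),
          σ • P - (ψ ((modNCyclotomicCharacter ℚ d σ : (ZMod d)ˣ) : ZMod d)).val • P ∈ Φ₀) ∧
        (∀ v ∈ S₀, ((3 : ℕ) : 𝓞 ℚ) ∉ v.asIdeal) ∧
        (∀ v : HeightOneSpectrum (𝓞 ℚ), v ∉ S₀ → ((3 : ℕ) : 𝓞 ℚ) ∉ v.asIdeal → U.HasGoodReductionAt v) ∧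
        1 + ∑ v ∈ S₀, delta U 3 v =
          ∑ v ∈ S₀, ((if φ (Rat.HeightOneSpectrum.natGenerator v : ZMod m) =
                (Rat.HeightOneSpectrum.natGenerator v : ZMod 3)
              then sFactor 3 (Rat.HeightOneSpectrum.natGenerator v) else 0) +
            (if ψ (Rat.HeightOneSpectrum.natGenerator v : ZMod d) =
                (Rat.HeightOneSpectrum.natGenerator v : ZMod 3)
              then sFactor 3 (Rat.HeightOneSpectrum.natGenerator v) else 0)))) := by
  induction hz with
  | refl => exact ⟨hmult, Iff.rfl⟩
  | tail _ hbc ih =>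
    obtain ⟨hmb, hiff⟩ := ih
    rcases hbc with hf | ⟨hb, _, _, hcell⟩
    · exact ⟨hasMultiplicativeReductionAtPrime_of_twoStepAt hf hmb,
        hiff.trans ⟨subrowDatum_of_twoStepAt hf hmb q, subrowDatum_of_twoStepAt_symm hf hmb q⟩⟩
    · have hmc := hcell.2.1.2.2
      exact ⟨hmc, hiff.trans ⟨subrowDatum_of_twoStepAt_symm hb hmc q, subrowDatum_of_twoStepAt hb hmc q⟩⟩

/-! ## §4. Constant on components up to isogeny at the ends -/

/-- **THE SUB-ROW IS A UNION OF CONNECTED COMPONENTS (up to isogeny).** For globally minimal `W` multiplicative at `3`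
and the shape of the stub's data — `W ∼ W₁`, a zig-zag `W₁ ⇝ U`, `U ∼ W₀` —, the sub-row datum holds at `W` iff it holds
at `W₀` (§3 between `W₁` and `U`; ISO-2 `subrowDatum_iff_of_isIsogenous` at both ends; multiplicativity along the first
isogeny by `X2.IsogenyQuotientLine.hasMultiplicativeReductionAtPrime_of_isIsogenous`). Hence the hypothesis
«¬ sub-row datum» of `stub_offSubrow_connectedShaUnitOrPartner` is constant on exactly the components over which its
two disjuncts range. [cite: GreenbergVatsal2000, §2 Prop. (2.4) p. 22 and §3 (28) p. 42] [cite: SilvermanAEC2009, III.4 and X.5 Cor. 5.4] -/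
theorem subrowDatum_iff_of_isIsogenous_zigzag {W : WeierstrassCurve ℚ} [W.IsElliptic]
    {W₁ : WeierstrassCurve ℚ} [W₁.IsElliptic] {U : WeierstrassCurve ℚ} [U.IsElliptic] {W₀ : WeierstrassCurve ℚ} [W₀.IsElliptic]
    (h₁ : IsIsogenous W W₁)
    (hz : Relation.ReflTransGen (fun A B : WeierstrassCurve ℚ ↦ TwoStepAt 3 A B ∨
        (TwoStepAt 3 B A ∧ ∃ (_ : B.IsElliptic) (_ : B.IsGloballyMinimal), X2.CellB B 3)) W₁ U)
    (h₀ : IsIsogenous U W₀) (hmult : W.HasMultiplicativeReductionAtPrime 3) (q : ℕ) :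
    (q = 3 ∧ ¬ W.HasSplitMultiplicativeReductionAtPrime 3 ∧
      ∃ (Φ₀ : AddSubgroup (geomTorsion W (3 : ℤ))) (m : ℕ) (_ : NeZero m) (φ : DirichletCharacter (ZMod 3) m)
        (d : ℕ) (_ : NeZero d) (ψ : DirichletCharacter (ZMod 3) d) (S₀ : Finset (HeightOneSpectrum (𝓞 ℚ))),
        IsRationalLine W 3 Φ₀ ∧ φ.IsPrimitive ∧ ψ.IsPrimitive ∧
        (∀ (σ : absoluteGaloisGroup ℚ), ∀ P ∈ Φ₀,
          σ • P = (φ ((modNCyclotomicCharacter ℚ m σ : (ZMod m)ˣ) : ZMod m)).val • P) ∧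
        (∀ (σ : absoluteGaloisGroup ℚ) (P : geomTorsion W (3 : ℤ)),
          σ • P - (ψ ((modNCyclotomicCharacter ℚ d σ : (ZMod d)ˣ) : ZMod d)).val • P ∈ Φ₀) ∧
        (∀ v ∈ S₀, ((3 : ℕ) : 𝓞 ℚ) ∉ v.asIdeal) ∧
        (∀ v : HeightOneSpectrum (𝓞 ℚ), v ∉ S₀ → ((3 : ℕ) : 𝓞 ℚ) ∉ v.asIdeal → W.HasGoodReductionAt v) ∧
        1 + ∑ v ∈ S₀, delta W 3 v =
          ∑ v ∈ S₀, ((if φ (Rat.HeightOneSpectrum.natGenerator v : ZMod m) =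
                (Rat.HeightOneSpectrum.natGenerator v : ZMod 3)
              then sFactor 3 (Rat.HeightOneSpectrum.natGenerator v) else 0) +
            (if ψ (Rat.HeightOneSpectrum.natGenerator v : ZMod d) =
                (Rat.HeightOneSpectrum.natGenerator v : ZMod 3)
              then sFactor 3 (Rat.HeightOneSpectrum.natGenerator v) else 0))) ↔
    (q = 3 ∧ ¬ W₀.HasSplitMultiplicativeReductionAtPrime 3 ∧
      ∃ (Φ₀ : AddSubgroup (geomTorsion W₀ (3 : ℤ))) (m : ℕ) (_ : NeZero m) (φ : DirichletCharacter (ZMod 3) m)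
        (d : ℕ) (_ : NeZero d) (ψ : DirichletCharacter (ZMod 3) d) (S₀ : Finset (HeightOneSpectrum (𝓞 ℚ))),
        IsRationalLine W₀ 3 Φ₀ ∧ φ.IsPrimitive ∧ ψ.IsPrimitive ∧
        (∀ (σ : absoluteGaloisGroup ℚ), ∀ P ∈ Φ₀,
          σ • P = (φ ((modNCyclotomicCharacter ℚ m σ : (ZMod m)ˣ) : ZMod m)).val • P) ∧
        (∀ (σ : absoluteGaloisGroup ℚ) (P : geomTorsion W₀ (3 : ℤ)),
          σ • P - (ψ ((modNCyclotomicCharacter ℚ d σ : (ZMod d)ˣ) : ZMod d)).val • P ∈ Φ₀) ∧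
        (∀ v ∈ S₀, ((3 : ℕ) : 𝓞 ℚ) ∉ v.asIdeal) ∧
        (∀ v : HeightOneSpectrum (𝓞 ℚ), v ∉ S₀ → ((3 : ℕ) : 𝓞 ℚ) ∉ v.asIdeal → W₀.HasGoodReductionAt v) ∧
        1 + ∑ v ∈ S₀, delta W₀ 3 v =
          ∑ v ∈ S₀, ((if φ (Rat.HeightOneSpectrum.natGenerator v : ZMod m) =
                (Rat.HeightOneSpectrum.natGenerator v : ZMod 3)
              then sFactor 3 (Rat.HeightOneSpectrum.natGenerator v) else 0) +
            (if ψ (Rat.HeightOneSpectrum.natGenerator v : ZMod d) =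
                (Rat.HeightOneSpectrum.natGenerator v : ZMod 3)
              then sFactor 3 (Rat.HeightOneSpectrum.natGenerator v) else 0))) := by
  have hm₁ : W₁.HasMultiplicativeReductionAtPrime 3 :=
    IsogenyQuotientLine.hasMultiplicativeReductionAtPrime_of_isIsogenous h₁ hmult
  exact (subrowDatum_iff_of_isIsogenous h₁ q).trans
    ((subrowDatum_iff_of_zigzag hz hm₁ q).2.trans (subrowDatum_iff_of_isIsogenous h₀ q))

end Summit.BirchSwinnertonDyer.BirchSwinnertonDyer.Theorems.EisensteinPrimesMazurMCOnCellBTwistbackSubrowDatumZigzag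

end
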